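import Summits.ValiantsHypothesis.ValiantsHypothesis.Theorems.NcPairingPermanent
import HarnessLib

/-!
# Small-ball counting for ±1 sums over position sets — F1 of O-L6-21 (the few-shapes rung)

THE LEMMAS. For a mask `Y : Fin d → Bool` and a position set `A`, `bsum Y A = Σ_{j ∈ A} ±1` is the
signed sum of `Y` over `A`. This file proves, by pure counting over the cube `Fin d → Bool`:
(M2) `Σ_Y bsum(Y,A)² = |A|·2^d` (`sum_bsum_sq`); (M4) `Σ_Y bsum(Y,A)⁴ = (3|A|² − 2|A|)·2^d`
(`sum_bsum_pow_four`, `sum_bsum_pow_four_le`) — both by induction on `A`, the odd terms vanishing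
under the flip of one coordinate (`sum_sign_mul_eq_zero`); ★ the SMALL-BALL COUNT (Paley–Zygmund
by counting, no Cauchy–Schwarz: the pointwise inequality `8|A|·S² ≤ S⁴ + 16|A|²`):
`|A| ≥ 4h² ⟹ 16·#{Y : |bsum(Y,A)| < h} ≤ 13·2^d` (`small_ball`); the MIXING LEMMA
`#(E ∩ F)·2^d = #E·#F` for events `E`, `F` depending on complementary coordinate sets
(`card_inter_mul_two_pow`, an explicit involution of the square of the cube); and ★ the PRODUCT
BOUND over pairwise-disjoint tests `(A_i, h_i)` with `|A_i| ≥ 4h_i²`: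
`16^r·#{Y : ∀ i, |bsum(Y,A_i)| < h_i} ≤ 13^r·2^d` (`small_ball_prod`).
ROLE IN THE SERIES (O-L6-21, decomp-valiant lens 6): F1 (this, Mathlib-only mathematics) →
F2 `NcShapeRings` (the ring certificate of a parse-tree shape) → F3 `NcShapeAnticoncentration`
(the count `card_undesignated_le`, FLOS20 Lemma 21 / LLS18 Claim 15 in counting form, and the
union bound over a list of shapes) → F4 `NcFewShapesPermanent` (the few-shapes rung for
`PERM_{2n}`, FLOS20 Theorem 23 / LLS18 Theorem 13 in kernel form).
HONEST LINE: elementary probability written as cardinalities; nothing here mentions circuits;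
instrument only; 0 S-currency; closes NO item; A_nc stmt-23446 / PerNotNcVP / VP ≠ VNP untouched.
HONEST BOUNDARY pointer (verbatim sentence + critic LABEL in F4 `NcFewShapesPermanent`): the series
proves a RUNG on the commutativity dial in a RESTRICTED MODEL (few full-degree parse-tree SHAPES),
print-KNOWN (FLOS20 Thm 23 / LLS18 Thm 13), S-implied · WEAKER than A_nc =
`CommutativityDial.PerNotNcVP` (stmt-23446, OPEN · UNDECIDED · IDEA-NEEDED); VP ≠ VNP untouched.
[cite: FijalkowLagardeOhlmannSerre2020, Lemma 21, Appendix (proof of Lemma 21)]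
[cite: LagardeLimayeSrinivasan2018, Claim 15, Subclaim 16]
-/

noncomputable section

open Finset

namespace Summit.ValiantsHypothesis.ValiantsHypothesis.Theorems.NcSignSmallBall

set_option linter.dupNamespace false

/-! ### §1 Signed sums and the flip of one coordinate -/

/-- The ±1 sum of the mask `Y` over the position set `A`.
[cite: FijalkowLagardeOhlmannSerre2020, Lemma 21] -/
def bsum {d : ℕ} (Y : Fin d → Bool) (A : Finset (Fin d)) : ℤ :=
  ∑ j ∈ A, (if Y j = true then (1 : ℤ) else -1)

/-- Masks agreeing on `A` have the same sum over `A`.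
[cite: FijalkowLagardeOhlmannSerre2020, Lemma 21] -/
theorem bsum_congr {d : ℕ} {Y Y' : Fin d → Bool} {A : Finset (Fin d)}
    (h : ∀ j ∈ A, Y j = Y' j) : bsum Y A = bsum Y' A := by
  unfold bsum
  exact Finset.sum_congr rfl fun j hj => by rw [h j hj]

/-- One more position. [cite: FijalkowLagardeOhlmannSerre2020, Lemma 21] -/
theorem bsum_insert {d : ℕ} (Y : Fin d → Bool) {a : Fin d} {A : Finset (Fin d)} (ha : a ∉ A) :
    bsum Y (insert a A) = (if Y a = true then (1 : ℤ) else -1) + bsum Y A := by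
  unfold bsum
  rw [Finset.sum_insert ha]

/-- A sign squares to `1`. [cite: FijalkowLagardeOhlmannSerre2020, Lemma 21] -/
theorem sign_sq {d : ℕ} (Y : Fin d → Bool) (a : Fin d) :
    (if Y a = true then (1 : ℤ) else -1) ^ 2 = 1 := by
  split_ifs <;> norm_num

/-- Changing the coordinate `a` keeps every sum avoiding `a`.
[cite: FijalkowLagardeOhlmannSerre2020, Lemma 21] -/
theorem bsum_update {d : ℕ} (Y : Fin d → Bool) (a : Fin d) (b : Bool) {A : Finset (Fin d)}
    (ha : a ∉ A) : bsum (Function.update Y a b) A = bsum Y A :=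
  bsum_congr fun _ hj => Function.update_of_ne (ne_of_mem_of_not_mem hj ha) b Y

/-- Odd functionals of the sign at `a` against sums avoiding `a` vanish (flip the coordinate `a`:
a fixed-point-free involution of the cube). [cite: FijalkowLagardeOhlmannSerre2020, Lemma 21] -/
theorem sum_sign_mul_eq_zero {d : ℕ} (a : Fin d) {A : Finset (Fin d)} (ha : a ∉ A) (φ : ℤ → ℤ) :
    ∑ Y : Fin d → Bool, (if Y a = true then (1 : ℤ) else -1) * φ (bsum Y A) = 0 := by
  refine Finset.sum_ninvolution (fun Y => Function.update Y a (!Y a)) ?_ ?_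
    (fun Y => Finset.mem_univ _) ?_
  · intro Y
    rw [bsum_update Y a (!Y a) ha, Function.update_self]
    rcases Bool.eq_false_or_eq_true (Y a) with h | h <;> simp [h]
  · intro Y _ h
    have h1 := congr_fun h a
    rw [Function.update_self] at h1
    exact absurd h1 (Bool.not_ne_self (Y a))
  · intro Y
    rw [Function.update_self, Bool.not_not, Function.update_idem, Function.update_eq_self]

/-- The cube has `2^d` masks. [cite: FijalkowLagardeOhlmannSerre2020, Lemma 21] -/
theorem card_masks (d : ℕ) : (univ : Finset (Fin d → Bool)).card = 2 ^ d := by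
  rw [Finset.card_univ, Fintype.card_fun, Fintype.card_bool, Fintype.card_fin]

/-! ### §2 Second and fourth moments -/

/-- Second moment: `Σ_Y bsum(Y,A)² = |A|·2^d`. [cite: FijalkowLagardeOhlmannSerre2020, Lemma 21] -/
theorem sum_bsum_sq {d : ℕ} (A : Finset (Fin d)) :
    ∑ Y : Fin d → Bool, bsum Y A ^ 2 = (A.card : ℤ) * 2 ^ d := by
  induction A using Finset.induction_on with
  | empty => simp [bsum]
  | @insert a A ha ih =>
    have hY : ∀ Y : Fin d → Bool, bsum Y (insert a A) ^ 2 =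
        bsum Y A ^ 2 + 1 + (if Y a = true then (1 : ℤ) else -1) * (2 * bsum Y A) := by
      intro Y
      rw [bsum_insert Y ha]
      linear_combination sign_sq Y a
    have h0 : ∑ Y : Fin d → Bool, (if Y a = true then (1 : ℤ) else -1) * (2 * bsum Y A) = 0 :=
      sum_sign_mul_eq_zero a ha (fun x => 2 * x)
    rw [Finset.sum_congr rfl fun Y _ => hY Y, Finset.sum_add_distrib, Finset.sum_add_distrib, h0,
      ih, Finset.sum_const, card_masks, Finset.card_insert_of_notMem ha, nsmul_eq_mul, mul_one]
    push_cast
    ring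

/-- Fourth moment, exact: `Σ_Y bsum(Y,A)⁴ = (3|A|² − 2|A|)·2^d`.
[cite: FijalkowLagardeOhlmannSerre2020, Lemma 21] -/
theorem sum_bsum_pow_four {d : ℕ} (A : Finset (Fin d)) :
    ∑ Y : Fin d → Bool, bsum Y A ^ 4 = (3 * (A.card : ℤ) ^ 2 - 2 * A.card) * 2 ^ d := by
  induction A using Finset.induction_on with
  | empty => simp [bsum]
  | @insert a A ha ih =>
    have hY : ∀ Y : Fin d → Bool, bsum Y (insert a A) ^ 4 =
        bsum Y A ^ 4 + 6 * bsum Y A ^ 2 + 1 +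
          (if Y a = true then (1 : ℤ) else -1) * (4 * bsum Y A ^ 3 + 4 * bsum Y A) := by
      intro Y
      rw [bsum_insert Y ha]
      linear_combination ((if Y a = true then (1 : ℤ) else -1) ^ 2 + 1 +
        4 * (if Y a = true then (1 : ℤ) else -1) * bsum Y A + 6 * bsum Y A ^ 2) * sign_sq Y a
    have h0 : ∑ Y : Fin d → Bool,
        (if Y a = true then (1 : ℤ) else -1) * (4 * bsum Y A ^ 3 + 4 * bsum Y A) = 0 :=
      sum_sign_mul_eq_zero a ha (fun x => 4 * x ^ 3 + 4 * x)
    rw [Finset.sum_congr rfl fun Y _ => hY Y, Finset.sum_add_distrib, Finset.sum_add_distrib,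
      Finset.sum_add_distrib, h0, ih, ← Finset.mul_sum, sum_bsum_sq A, Finset.sum_const, card_masks,
      Finset.card_insert_of_notMem ha, nsmul_eq_mul, mul_one]
    push_cast
    ring

/-- Fourth moment, bound: `Σ_Y bsum(Y,A)⁴ ≤ 3|A|²·2^d`.
[cite: FijalkowLagardeOhlmannSerre2020, Lemma 21] -/
theorem sum_bsum_pow_four_le {d : ℕ} (A : Finset (Fin d)) :
    ∑ Y : Fin d → Bool, bsum Y A ^ 4 ≤ 3 * (A.card : ℤ) ^ 2 * 2 ^ d := by
  rw [sum_bsum_pow_four]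
  have h1 : (0 : ℤ) ≤ A.card := Nat.cast_nonneg _
  have h2 : (0 : ℤ) < 2 ^ d := pow_pos (by norm_num) d
  nlinarith

/-! ### §3 The small-ball count (Paley–Zygmund by counting) -/

/-- ★ Small ball: if `|A| ≥ 4h²` then at most `13/16` of all masks have `|bsum| < h`.
[cite: FijalkowLagardeOhlmannSerre2020, Lemma 21] [cite: LagardeLimayeSrinivasan2018, Claim 15] -/
theorem small_ball {d : ℕ} (A : Finset (Fin d)) (h : ℕ) (hA : 4 * h ^ 2 ≤ A.card) :
    16 * (univ.filter (fun Y : Fin d → Bool => |bsum Y A| < h)).card ≤ 13 * 2 ^ d := by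
  rcases Nat.eq_zero_or_pos h with rfl | hpos
  · -- `|bsum| < 0` never happens
    rw [Finset.filter_false_of_mem (fun Y _ => by push_cast; exact not_lt.2 (abs_nonneg _)),
      Finset.card_empty, mul_zero]
    exact Nat.zero_le _
  set L := univ.filter (fun Y : Fin d → Bool => |bsum Y A| < h) with hL
  set Bs := univ.filter (fun Y : Fin d → Bool => ¬ |bsum Y A| < h) with hBs
  have hLB : L.card + Bs.card = 2 ^ d := by
    rw [hL, hBs, Finset.card_filter_add_card_filter_not, card_masks]
  -- the moments, split along `L ⊔ Bs`
  have e1 : ∑ Y ∈ L, bsum Y A ^ 2 + ∑ Y ∈ Bs, bsum Y A ^ 2 = (A.card : ℤ) * 2 ^ d := by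
    rw [hL, hBs, Finset.sum_filter_add_sum_filter_not, sum_bsum_sq]
  have e3 : ∑ Y ∈ L, bsum Y A ^ 2 ≤ (2 : ℤ) ^ d * h ^ 2 := by
    calc ∑ Y ∈ L, bsum Y A ^ 2 ≤ ∑ Y ∈ L, (h : ℤ) ^ 2 := by
          refine Finset.sum_le_sum fun Y hY => ?_
          rw [hL, Finset.mem_filter] at hY
          have h3 := abs_lt.1 hY.2
          exact (sq_lt_sq' h3.1 h3.2).le
      _ = (L.card : ℤ) * h ^ 2 := by rw [Finset.sum_const, nsmul_eq_mul]
      _ ≤ (2 : ℤ) ^ d * h ^ 2 := by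
          have h4 : (L.card : ℤ) ≤ 2 ^ d := by exact_mod_cast hLB ▸ Nat.le_add_right L.card Bs.card
          have h5 : (0 : ℤ) ≤ (h : ℤ) ^ 2 := sq_nonneg _
          exact mul_le_mul_of_nonneg_right h4 h5
  have e4 : ∑ Y ∈ Bs, bsum Y A ^ 4 ≤ 3 * (A.card : ℤ) ^ 2 * 2 ^ d :=
    (Finset.sum_le_sum_of_subset_of_nonneg (Finset.filter_subset _ _)
      (fun Y _ _ => by positivity)).trans (sum_bsum_pow_four_le A)
  have e5 : 8 * (A.card : ℤ) * ∑ Y ∈ Bs, bsum Y A ^ 2 ≤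
      ∑ Y ∈ Bs, bsum Y A ^ 4 + 16 * (A.card : ℤ) ^ 2 * Bs.card := by
    rw [Finset.mul_sum]
    calc ∑ Y ∈ Bs, 8 * (A.card : ℤ) * bsum Y A ^ 2
        ≤ ∑ Y ∈ Bs, (bsum Y A ^ 4 + 16 * (A.card : ℤ) ^ 2) :=
          Finset.sum_le_sum fun Y _ => by nlinarith [sq_nonneg (bsum Y A ^ 2 - 4 * (A.card : ℤ))]
      _ = ∑ Y ∈ Bs, bsum Y A ^ 4 + 16 * (A.card : ℤ) ^ 2 * Bs.card := by
          rw [Finset.sum_add_distrib, Finset.sum_const, nsmul_eq_mul]; ring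
  -- arithmetic
  have hM4 : (4 : ℤ) * h ^ 2 ≤ A.card := by exact_mod_cast hA
  have hM1 : (1 : ℤ) ≤ A.card := by
    have h6 : (1 : ℤ) ≤ h := by exact_mod_cast hpos
    nlinarith
  have hN : (0 : ℤ) < 2 ^ d := pow_pos (by norm_num) d
  have hh : (2 : ℤ) ^ d * (4 * h ^ 2) ≤ 2 ^ d * A.card := mul_le_mul_of_nonneg_left hM4 hN.le
  have hB1 : 3 * ((A.card : ℤ) * 2 ^ d) ≤ 4 * ∑ Y ∈ Bs, bsum Y A ^ 2 := by linarith
  have hB2 : (A.card : ℤ) * (3 * ((A.card : ℤ) * 2 ^ d)) ≤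
      (A.card : ℤ) * (4 * ∑ Y ∈ Bs, bsum Y A ^ 2) := mul_le_mul_of_nonneg_left hB1 (by linarith)
  have key : (A.card : ℤ) ^ 2 * (3 * 2 ^ d) ≤ (A.card : ℤ) ^ 2 * (16 * Bs.card) := by linarith
  have key' : (3 : ℤ) * 2 ^ d ≤ 16 * Bs.card := le_of_mul_le_mul_left key (by positivity)
  have hfin : (16 : ℤ) * L.card ≤ 13 * 2 ^ d := by
    have h7 : (L.card : ℤ) + Bs.card = 2 ^ d := by exact_mod_cast hLB
    linarith
  exact_mod_cast hfin

/-! ### §4 Mixing and the product bound -/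

/-- Mixing lemma: events depending on complementary coordinate sets multiply
(`E` depends only on the coordinates in `A`, `F` only on those outside `A`; the splice involution
`(Y,Y') ↦ (Y|_A ∪ Y'|_{Aᶜ}, Y'|_A ∪ Y|_{Aᶜ})` maps `E × F` onto `(E ∩ F) × univ`).
[cite: FijalkowLagardeOhlmannSerre2020, Lemma 21] -/
theorem card_inter_mul_two_pow {d : ℕ} (E F : Finset (Fin d → Bool)) (A : Finset (Fin d))
    (hE : ∀ Y Y' : Fin d → Bool, (∀ j ∈ A, Y j = Y' j) → (Y ∈ E ↔ Y' ∈ E))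
    (hF : ∀ Y Y' : Fin d → Bool, (∀ j ∉ A, Y j = Y' j) → (Y ∈ F ↔ Y' ∈ F)) :
    (E ∩ F).card * 2 ^ d = E.card * F.card := by
  -- the splice: coordinates in `A` from the first mask, the others from the second
  have hsp : ∃ sp : (Fin d → Bool) → (Fin d → Bool) → (Fin d → Bool),
      (∀ Y Y', ∀ j ∈ A, sp Y Y' j = Y j) ∧ (∀ Y Y', ∀ j ∉ A, sp Y Y' j = Y' j) :=
    ⟨fun Y Y' j => if j ∈ A then Y j else Y' j, fun Y Y' j hj => if_pos hj,
      fun Y Y' j hj => if_neg hj⟩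
  obtain ⟨sp, hspA, hspN⟩ := hsp
  have hinv : ∀ Y Y', sp (sp Y Y') (sp Y' Y) = Y := by
    intro Y Y'
    funext j
    by_cases hj : j ∈ A
    · rw [hspA _ _ j hj, hspA _ _ j hj]
    · rw [hspN _ _ j hj, hspN _ _ j hj]
  have key : (E ×ˢ F).card = ((E ∩ F) ×ˢ (univ : Finset (Fin d → Bool))).card := by
    refine Finset.card_nbij' (fun p => (sp p.1 p.2, sp p.2 p.1)) (fun p => (sp p.1 p.2, sp p.2 p.1))
      ?_ ?_ (fun p _ => Prod.ext (hinv p.1 p.2) (hinv p.2 p.1))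
      (fun p _ => Prod.ext (hinv p.1 p.2) (hinv p.2 p.1))
    · intro p hp
      rw [Finset.mem_coe, Finset.mem_product] at hp
      rw [Finset.mem_coe, Finset.mem_product, Finset.mem_inter]
      exact ⟨⟨(hE p.1 _ fun j hj => (hspA p.1 p.2 j hj).symm).1 hp.1,
        (hF p.2 _ fun j hj => (hspN p.1 p.2 j hj).symm).1 hp.2⟩, Finset.mem_univ _⟩
    · intro p hp
      rw [Finset.mem_coe, Finset.mem_product, Finset.mem_inter] at hp
      rw [Finset.mem_coe, Finset.mem_product]
      exact ⟨(hE p.1 _ fun j hj => (hspA p.1 p.2 j hj).symm).1 hp.1.1,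
        (hF p.1 _ fun j hj => (hspN p.2 p.1 j hj).symm).1 hp.1.2⟩
  rw [Finset.card_product, Finset.card_product, card_masks] at key
  exact key.symm

/-- ★ Product bound over pairwise-disjoint tests `(A_i, h_i)` with `|A_i| ≥ 4h_i²`: the masks
passing every test (`|bsum(Y,A_i)| < h_i`) are at most `(13/16)^r · 2^d`.
[cite: FijalkowLagardeOhlmannSerre2020, Lemma 21] [cite: LagardeLimayeSrinivasan2018, Claim 15] -/
theorem small_ball_prod {d : ℕ} (tests : List (Finset (Fin d) × ℕ))
    (hdisj : tests.Pairwise (fun s t => Disjoint s.1 t.1))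
    (hbig : ∀ t ∈ tests, 4 * t.2 ^ 2 ≤ t.1.card) :
    16 ^ tests.length *
        (univ.filter (fun Y : Fin d → Bool => ∀ t ∈ tests, |bsum Y t.1| < t.2)).card ≤
      13 ^ tests.length * 2 ^ d := by
  induction tests with
  | nil =>
    rw [Finset.filter_true_of_mem (fun Y _ => fun t ht => by simp at ht), card_masks,
      List.length_nil, pow_zero, pow_zero]
  | cons t rest ih =>
    rw [List.pairwise_cons] at hdisj
    set E := univ.filter (fun Y : Fin d → Bool => |bsum Y t.1| < t.2) with hEdef
    set F := univ.filter (fun Y : Fin d → Bool => ∀ s ∈ rest, |bsum Y s.1| < s.2) with hFdef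
    have hsplit : univ.filter (fun Y : Fin d → Bool => ∀ s ∈ t :: rest, |bsum Y s.1| < s.2) =
        E ∩ F := by
      ext Y
      simp only [hEdef, hFdef, Finset.mem_filter, Finset.mem_univ, true_and, Finset.mem_inter,
        List.forall_mem_cons]
    have hE' : ∀ Y Y' : Fin d → Bool, (∀ j ∈ t.1, Y j = Y' j) → (Y ∈ E ↔ Y' ∈ E) := by
      intro Y Y' hYY'
      simp only [hEdef, Finset.mem_filter, Finset.mem_univ, true_and]
      rw [bsum_congr hYY']
    have hF' : ∀ Y Y' : Fin d → Bool, (∀ j ∉ t.1, Y j = Y' j) → (Y ∈ F ↔ Y' ∈ F) := by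
      intro Y Y' hYY'
      simp only [hFdef, Finset.mem_filter, Finset.mem_univ, true_and]
      refine forall₂_congr fun s hs => ?_
      rw [bsum_congr (fun j hj => hYY' j (Finset.disjoint_right.1 (hdisj.1 s hs) hj))]
    have hm := card_inter_mul_two_pow E F t.1 hE' hF'
    have h1 := small_ball t.1 t.2 (hbig t (by simp))
    have h2 := ih hdisj.2 (fun s hs => hbig s (List.mem_cons.2 (Or.inr hs)))
    rw [hsplit, List.length_cons]
    refine Nat.le_of_mul_le_mul_right ?_ (Nat.two_pow_pos d)
    calc 16 ^ (rest.length + 1) * (E ∩ F).card * 2 ^ d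
        = 16 * E.card * (16 ^ rest.length * F.card) := by rw [mul_assoc, hm]; ring
      _ ≤ 13 * 2 ^ d * (13 ^ rest.length * 2 ^ d) := Nat.mul_le_mul h1 h2
      _ = 13 ^ (rest.length + 1) * 2 ^ d * 2 ^ d := by ring

end Summit.ValiantsHypothesis.ValiantsHypothesis.Theorems.NcSignSmallBall
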